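import Literature.MathematicalPhysics.QuantumFieldTheory.Balaban1983to89.B9Thm312Whole
import Literature.MathematicalPhysics.QuantumFieldTheory.Balaban1983to89.B9Thm37GlueCor36
import Literature.MathematicalPhysics.QuantumFieldTheory.Balaban1983to89.B9Thm37AllNormsInstances
import Literature.MathematicalPhysics.QuantumFieldTheory.Balaban1983to89.B9SectBStepWhole

/-!
# `Balaban1983to89.B9Thm312WholeLeaf` — [B9] Theorem 3.12 (p. 423) AS THE WHOLE PRINTED LEAF `B9.Thm312Printed`, II: the
# glue theorems over `…B9Thm312Whole`'s letters, pins and schemas (one member ∕ one U; the family)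

T. Bałaban, *Propagators for lattice gauge theories in a background field*, Commun. Math. Phys. **99** (1985) 389–434
[`Balaban1985BackgroundPropagators`, "B9"]; [4] = T. Bałaban, *Propagators and renormalization transformations for lattice
gauge theories. II*, Commun. Math. Phys. **96** (1984) 223–250 [`Balaban1984PropagatorsII`].

statement-level skeleton of published theorems with citation tags; proofs where landed; nothing here is a claim about the
Yang–Mills mass gap

THE PRINTED LOCI are those of `…B9Thm312Whole` (pp. 420–426: (3.126), (3.129), (3.130), (3.131), (3.138), (3.147), (3.153),
Theorem 3.12 p. 423 verbatim there); p. 422: *"This inequality [(3.131)] and Theorem 3.3 for G₀ imply a convergence of the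
series (3.130), for α₀ sufficiently small, in all norms appearing on the left-hand sides of the inequalities (3.42)–(3.47),
except the inequality involving the Laplace operator in (3.42). Thus we have Theorem 3.3. for G, with this exception. Of
course Theorem 3.10 holds also because we replace each operator in (3.130) by its random walk expansion."*

WHAT THIS FILE PROVES (theorems only — 0 `def`, 0 named fact, 0 sorry; the letters `Ops`, the pins `PosDefKOfOps` ∕
`HasRWExpOfOps` ∕ `HasRWExpHOfOps`, the state norms `cNorm` and the schemas `GeoOK` ∕ `Thm33G0` ∕ `Step` ∕ `FormSmall` ∕
`Identities` are `…B9Thm312Whole`'s):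
* §4 ONE MEMBER, ONE U — `hasMaj_cNorm_of_hasMaj` ∕ `hasMajorantHom_of_hasMaj_cNorm` (moving the scale weights (L^jη)^{±p}
  between the kernels and the rescaled sup norms, `B9SectDSup.HasMaj.weight`), `exists_hasMaj_const_cNorm` (the a-priori
  bound of the finite lattice, `B9Thm37AllNorms.exists_hasMaj_const_ofBlocks`), `fix_of_inverses` ((3.130) as a resolvent
  identity), `hasMaj_right_of_step` (THE RIGHT ENTRIES G𝒳 WITH DECAY, `B9SectDSup.rightEntry_majorant` =
  `B11SectG.neumann_majorant`), `entry0_of_step` ∕ `entry2_of_step` ((3.42)₁, (3.42)₃ for G or G₁ in the printed sup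
  shapes, constant B₀(1 − θc)⁻¹), `hasMaj_pow_comp_const` + `seriesConv_of_step` (the remainder (G₀Δ′_π)ᴺG → 0, hence
  (3.130) ∕ (3.138) converge pointwise: `B11SectG.neumann_telescope`), `posDef_of_formSmall` (Δ_a > 0, |⟨f,Tf⟩| ≦ r⟨f,Δ_af⟩,
  r < 1, (Δ_a − T)A = I ⇒ A > 0), `Q_frakP` ∕ `RDs_frakP` ∕ `dot_GG_eq` ∕ `GG_nonneg` ∕ `GG_pos_on_constraint` (the
  dot-product twins of `B9FrakGPos`: Q𝔓 = 0, RD*𝔓 = 0, ⟨f, 𝔊f⟩ = ⟨𝔓*f, G₁𝔓*f⟩, 𝔊 ≥ 0, 𝔊 > 0 on {QA = 0, RD*A = 0}), and the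
  three pins INHABITED from the schemas: `posDefK_of_schemas`, `hasRWExp_of_schemas`, `hasRWExpH_of_schemas`;
  `eNoLap_of_clauses`, `ineq3133_mono`, `small_aux` (bookkeeping).
* §5 THE FAMILY: ★ **`thm312Printed_of_step`** — THE WHOLE PRINTED LEAF `B9.Thm312Printed d c35 geo bg GD G₁ H H₁
  (fun i => HasRWExpOfOps (𝔬 i)) (fun i => HasRWExpHOfOps (𝔬 i)) (fun i => PosDefKOfOps (𝔬 i))` for FREE kernel families
  `GD G₁ H H₁` (section variables of the `OperatorLayerY` field types) whose sup entries n = 0, 2 are CO-READ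
  (`B9Thm37GlueCor36.CoRealizes`) by G(U), G(U)∇*_U, G₁(U), G₁(U)∇*_U — from, per member and per U under the printed
  provisos (M ≧ M₁, 0 < α₀, Mα₀ ≦ a₁, (3.35), (3.36)): the schemas with the step constant θ₁·(Mα₀) (*"each operator Δ′_π
  provides the small factor α₀"*, p. 422) and the form constant r₁·(Mα₀); per member: `GeoOK`, [4] Lemma 2.1 (2.61) as
  `B11SectG.RowSum` for M ≧ M_L, the sign facts `B9FromB6ModelSignsOn.ModelSignsOn (geo i) (P i)` (ANY `P`; the Hölder
  monotonicity field is not used — dag-n06-d INTERFACE-1); and the RESIDUAL MEMBERS DISPLAYED as hypotheses of printed shape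
  with uniform constants (B₁, δ₁, B(β), B′(ε), B′(ε,β)): the left sup entry (3.42)₂ (∇_UG, ∇_UG₁ — its proof needs the
  factored sup ⊕ Hölder state space of `B9SectDSup` THEOREM S), the Hölder block (3.43)–(3.45), the L² block (3.46)
  (`B9SectDL2Decay`), the global block (3.47)₁₋₃, and (3.133) for H, H₁ (route: `B9Ineq3133Assembly.ineq3133_printed_sup ∕
  _holder`).  *"for α₀ sufficiently small"* is met with a₀ := min(a₁, (2(θ₁c + 1))⁻¹, (2(r₁ + 1))⁻¹) (q = θ₁(Mα₀)c ≦ ½).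

HONEST SCOPE.  Nothing of print is asserted: Theorem 3.3 for G₀, the step majorants ((3.131) and its Δ⁽²⁾ twin (3.137)),
the form bound, Theorem 3.11 for Δ_a, the identities of pp. 420–426 and [4] Lemma 2.1 are HYPOTHESES of printed shape;
the residual members listed above are NOT proved here; the pins read *"Theorem 3.10 holds"* as convergence of the printed
perturbation series (no walks) and *"Theorem 3.11 holds for 𝔊"* in `B9FrakGPos`' repaired sense.  Value: kernel-checked
bookkeeping — the printed leaf inhabited over the lineage's objects at explicit pins — NOT a node discharge, NOT summit
progress; one finite lattice at a time; nothing continuum, nothing about the mass gap.  Cell `pub-ymgap` (HUMAN RULING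
D-0062), Track A node N06 [B9], N06-ASSIGNMENT v1 row 20, seat `pub-ymgap-dag-n06-l`, 2026-08-26.
-/

namespace Literature.MathematicalPhysics.QuantumFieldTheory.Balaban1983to89.B9Thm312WholeLeaf

open Literature.MathematicalPhysics.QuantumFieldTheory.Balaban1983to89
open Finset Filter B6RandomWalk B6RandomWalkHom B9Thm34Ext B9Thm37GlueCor36 B11SectG B9SectDSup
open B9Thm37AllNorms B9Thm37AllNormsInstances B9FromB6 B9FromB6ModelSignsOn B9SectBStepWhole B9Thm312Whole
open _root_.Topology

noncomputable section

section OneMember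

variable {g : B9.Geometry} {B : B9.Backgrounds} {X Y Z W : Type}
variable [Fintype X] [Fintype Z] [Fintype W] [Fintype g.Site]

/-! ## §4 One member, one configuration U -/

omit [Fintype Z] [Fintype W] in
/-- **Rescaling a sharp-block majorant into the state norms**: a [4]-(2.51) majorant K ≧ 0 between the sharp-block sup
sizes of two lattices becomes, between 𝔠⁽q⁾ (source) and 𝔠⁽ᵖ⁾ (target), the majorant K(y,y′)(L^jη)^{−p}(L^{j′}η)^{q} —
`B9SectDSup.HasMaj.weight`, exact. [cite: Balaban1985BackgroundPropagators, p.398 (remark after (3.47))] -/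
theorem hasMaj_cNorm_of_hasMaj {V : Type} [Fintype V] {R₀ : ℝ} {H₀ : Prop} (hG : GeoOK g) {blkV : V → g.Site}
    {blk : X → g.Site} {T : (V → ℝ) →ₗ[ℝ] (X → ℝ)} {K : g.Site → g.Site → ℝ} (p q : ℕ)
    (h : HasMaj (BlockNorm.ofBlocks (toB6 g R₀ H₀) blkV) (BlockNorm.ofBlocks (toB6 g R₀ H₀) blk) T K) :
    HasMaj (cNorm R₀ H₀ blkV hG.lenle q) (cNorm R₀ H₀ blk hG.lenle p) T
      (fun y y' => K y y' * wt g p y * g.len y' ^ q) := by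
  refine HasMaj.weight (wt_nonneg hG.lenle q) (wt_nonneg hG.lenle p) h fun y y' => le_of_eq ?_
  have hy' : g.len y' ^ q ≠ 0 := pow_ne_zero q (hG.lenpos y').ne'
  simp only [wt]
  rw [mul_assoc (K y y' * (g.len y ^ p)⁻¹), mul_inv_cancel₀ hy', mul_one, mul_comm]

omit [Fintype Z] [Fintype W] in
/-- **Reading a state-norm majorant back as a [4]-(2.51) majorant**: a majorant K ≧ 0 from 𝔠⁽q⁾ into 𝔠⁽ᵖ⁾ is the two-space
sup majorant K(y,y′)(L^jη)ᵖ(L^{j′}η)^{−q} (the weights moved back into the kernel).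
[cite: Balaban1984PropagatorsII, (2.51) p.232; Balaban1985BackgroundPropagators, (3.42) p.397] -/
theorem hasMajorantHom_of_hasMaj_cNorm {V : Type} [Fintype V] {R₀ : ℝ} {H₀ : Prop} (hG : GeoOK g)
    {blkV : V → g.Site} {blk : X → g.Site} {T : (V → ℝ) →ₗ[ℝ] (X → ℝ)} {K : g.Site → g.Site → ℝ}
    (hK : ∀ a b, 0 ≤ K a b) {p q : ℕ}
    (h : HasMaj (cNorm R₀ H₀ blkV hG.lenle q) (cNorm R₀ H₀ blk hG.lenle p) T K) :
    HasMajorantHom (g := toB6 g R₀ H₀) blkV blk T (fun a b => K a b * g.len a ^ p * wt g q b) := by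
  intro y' μ B' hμ x
  have hloc : (cNorm R₀ H₀ blkV hG.lenle q).IsLoc y' μ := fun v hv => hμ.off v hv
  have hb := h y' μ hloc (blk x)
  simp only [cNorm, weightNorm_loc] at hb
  have hwt : 0 < wt g p (blk x) := wt_pos hG p (blk x)
  have h1 : |T μ x| ≤ (BlockNorm.ofBlocks (toB6 g R₀ H₀) blk).loc (blk x) (T μ) :=
    abs_apply_le_ofBlocks_loc (G := toB6 g R₀ H₀) blk (blk x) (T μ) x rfl
  have h2 : (BlockNorm.ofBlocks (toB6 g R₀ H₀) blkV).loc y' μ ≤ B' :=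
    ofBlocks_loc_le_of_blockSupp (G := toB6 g R₀ H₀) blkV hμ
  have h3 : (BlockNorm.ofBlocks (toB6 g R₀ H₀) blk).loc (blk x) (T μ) ≤
      (wt g p (blk x))⁻¹ * (K (blk x) y' * (wt g q y' * B')) := by
    rw [le_inv_mul_iff₀ hwt]
    exact hb.trans (mul_le_mul_of_nonneg_left (mul_le_mul_of_nonneg_left h2 (wt_nonneg hG.lenle q y')) (hK _ _))
  calc |T μ x| ≤ (wt g p (blk x))⁻¹ * (K (blk x) y' * (wt g q y' * B')) := h1.trans h3
    _ = K (blk x) y' * g.len (blk x) ^ p * wt g q y' * B' := by simp only [wt, inv_inv]; ring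

omit [Fintype Z] [Fintype W] in
/-- **The a-priori bound of the finite lattice in the state norms** (only to let N → ∞ in (3.130), as in [4] (2.66);
`B9Thm37AllNorms.exists_hasMaj_const_ofBlocks` rescaled). [cite: Balaban1984PropagatorsII, (2.66) p.234] -/
theorem exists_hasMaj_const_cNorm {V : Type} [Fintype V] (R₀ : ℝ) (H₀ : Prop) (hG : GeoOK g) (blkV : V → g.Site)
    (blk : X → g.Site) (T : (V → ℝ) →ₗ[ℝ] (X → ℝ)) (p q : ℕ) :
    ∃ M₀ : ℝ, 0 ≤ M₀ ∧ HasMaj (cNorm R₀ H₀ blkV hG.lenle q) (cNorm R₀ H₀ blk hG.lenle p) T (fun _ _ => M₀) := by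
  classical
  obtain ⟨M, hM, h⟩ := exists_hasMaj_const_ofBlocks (G := toB6 g R₀ H₀) blkV blk T
  set Wp : ℝ := ∑ y : g.Site, wt g p y with hWp
  set Lq : ℝ := ∑ y : g.Site, g.len y ^ q with hLq
  have hWp0 : 0 ≤ Wp := Finset.sum_nonneg fun y _ => wt_nonneg hG.lenle p y
  have hLq0 : 0 ≤ Lq := Finset.sum_nonneg fun y _ => pow_nonneg (hG.lenle y) q
  refine ⟨M * Wp * Lq, mul_nonneg (mul_nonneg hM hWp0) hLq0, ?_⟩
  refine (hasMaj_cNorm_of_hasMaj hG p q h).mono fun y y' => ?_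
  have h1 : wt g p y ≤ Wp := Finset.single_le_sum (fun z _ => wt_nonneg hG.lenle p z) (Finset.mem_univ y)
  have h2 : g.len y' ^ q ≤ Lq := Finset.single_le_sum (fun z _ => pow_nonneg (hG.lenle z) q) (Finset.mem_univ y')
  calc M * wt g p y * g.len y' ^ q ≤ M * Wp * g.len y' ^ q :=
        mul_le_mul_of_nonneg_right (mul_le_mul_of_nonneg_left h1 hM) (pow_nonneg (hG.lenle y') q)
    _ ≤ M * Wp * Lq := mul_le_mul_of_nonneg_left h2 (mul_nonneg hM hWp0)

omit [Fintype X] [Fintype Z] [Fintype W] [Fintype g.Site] in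
/-- **(3.130) as a resolvent identity**: G₀Δ_a = I and (Δ_a − Δ′_π)G = I give G = G₀ + G₀Δ′_πG (and the same for G₁ with
Δ′_π + Δ⁽²⁾_π, (3.138)) — the LEFT fixed-point form of `B11SectG.neumann_majorant`. [cite: Balaban1985BackgroundPropagators, (3.130) p.421 + (3.138) p.423] -/
theorem fix_of_inverses {G0 S0 T A : Module.End ℝ (X → ℝ)} (h0 : G0 * S0 = 1) (h : (S0 - T) * A = 1) :
    A = G0 + G0 ∘ₗ T ∘ₗ A := by
  have h1 : G0 * T * A = A - G0 := by
    calc G0 * T * A = G0 * (S0 - (S0 - T)) * A := by rw [sub_sub_cancel]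
      _ = G0 * S0 * A - G0 * ((S0 - T) * A) := by rw [mul_sub, sub_mul, mul_assoc G0 (S0 - T) A]
      _ = A - G0 := by rw [h0, h, one_mul, mul_one]
  have h2 : G0 ∘ₗ T ∘ₗ A = G0 * T * A := by
    rw [mul_assoc]; rfl
  rw [h2, h1, add_sub_cancel]

omit [Fintype Z] [Fintype W] in
/-- **THE RIGHT ENTRIES OF G (OR G₁) WITH DECAY, IN THE STATE NORMS** (`B9SectDSup.rightEntry_majorant` with 𝒢 = G₀, 𝒯 = Δ′_π
and the a-priori bound of the finite lattice discharged): if the step K′ = G₀T has majorant θe^{−δ_K d} on 𝔠⁽ᵖ⁾, the entry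
G₀𝒳 has Ae^{−ρ_S d} from 𝔠⁽q⁾ into 𝔠⁽ᵖ⁾, G = G₀ + G₀TG, the row sum (2.61) holds at rate σ with constant c, ρ ≦ ρ_S,
ρ + σ ≦ δ_K and q = θc < 1, then G𝒳 has majorant A(1 − θc)⁻¹e^{−ρd} from 𝔠⁽q⁾ into 𝔠⁽ᵖ⁾.
[cite: Balaban1985BackgroundPropagators, (3.130) p.421 + Thm 3.12 p.423; Balaban1984PropagatorsII, Lemma 2.1 p.234] -/
theorem hasMaj_right_of_step {V : Type} [Fintype V] {R₀ : ℝ} {H₀ : Prop} (hG : GeoOK g) {blkV : V → g.Site}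
    {blk : X → g.Site} {G0 T A : Module.End ℝ (X → ℝ)} {Fop : (V → ℝ) →ₗ[ℝ] (X → ℝ)} {p q : ℕ}
    {θ Aₛ δK ρS ρ σ c : ℝ} (hrow : RowSum (toB6 g R₀ H₀) σ c)
    (hθ : 0 ≤ θ) (hA : 0 ≤ Aₛ) (hρ : 0 ≤ ρ) (hρS : ρ ≤ ρS) (hρδ : ρ + σ ≤ δK)
    (hK : HasMaj (cNorm R₀ H₀ blk hG.lenle p) (cNorm R₀ H₀ blk hG.lenle p) (G0 ∘ₗ T)
      (fun a b => θ * Real.exp (-(δK * g.dist a b))))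
    (hS : HasMaj (cNorm R₀ H₀ blkV hG.lenle q) (cNorm R₀ H₀ blk hG.lenle p) (G0 ∘ₗ Fop)
      (fun a b => Aₛ * Real.exp (-(ρS * g.dist a b))))
    (hfix : A = G0 + G0 ∘ₗ T ∘ₗ A) (hq : θ * c < 1) :
    HasMaj (cNorm R₀ H₀ blkV hG.lenle q) (cNorm R₀ H₀ blk hG.lenle p) (A ∘ₗ Fop)
      (fun a b => Aₛ * (1 - θ * c)⁻¹ * Real.exp (-(ρ * g.dist a b))) := by
  obtain ⟨M₀, hM₀, hap⟩ := exists_hasMaj_const_cNorm R₀ H₀ hG blkV blk (A ∘ₗ Fop) p q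
  have htri : Triangle254 (toB6 g R₀ H₀) := fun a b c => hG.tri a b c
  have h := B9SectDSup.rightEntry_majorant (g := toB6 g R₀ H₀) (𝒢 := G0) (𝒯 := T) htri hG.dnn hrow hθ hA hM₀ hρ
    hρS hρδ hK hS hfix hap (by simpa using hq)
  simpa using h

omit [Fintype Z] [Fintype W] in
/-- **THEOREM 3.12, ENTRY (3.42)₁ FOR G (OR G₁), PRINTED SHAPE**: from (3.42)₁ for G₀ (B₀(L^jη)²e^{−δ₀d}), the step majorant
on 𝔠⁽²⁾ and the resolvent identity: |(G J)(x)| ≦ B₀(1 − θc)⁻¹(L^jη)²e^{−ρd(y,y′)}|J| for x ∈ Δ(y), supp J ⊂ Δ(y′).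
[cite: Balaban1985BackgroundPropagators, Thm 3.12 p.423 + (3.42) p.397 + (3.130) p.421] -/
theorem entry0_of_step {R₀ : ℝ} {H₀ : Prop} (hG : GeoOK g) {blk : X → g.Site} {G0 T A : Module.End ℝ (X → ℝ)}
    {θ B₀ δ₀ δK ρ σ c : ℝ} (hrow : RowSum (toB6 g R₀ H₀) σ c)
    (hθ : 0 ≤ θ) (hB₀ : 0 ≤ B₀) (hρ : 0 ≤ ρ) (hρS : ρ ≤ δ₀) (hρδ : ρ + σ ≤ δK)
    (hK : HasMaj (cNorm R₀ H₀ blk hG.lenle 2) (cNorm R₀ H₀ blk hG.lenle 2) (G0 ∘ₗ T)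
      (fun a b => θ * Real.exp (-(δK * g.dist a b))))
    (he0 : HasMajorant (g := toB6 g R₀ H₀) blk G0 (fun a b => B₀ * g.len a ^ 2 * Real.exp (-(δ₀ * g.dist a b))))
    (hfix : A = G0 + G0 ∘ₗ T ∘ₗ A) (hq : θ * c < 1) :
    HasMajorant (g := toB6 g R₀ H₀) blk A
      (fun a b => B₀ * (1 - θ * c)⁻¹ * g.len a ^ 2 * Real.exp (-(ρ * g.dist a b))) := by
  have hq1 : 0 ≤ (1 - θ * c)⁻¹ := inv_nonneg.mpr (by linarith)
  -- (3.42)₁ for G₀ in the state norms: 𝔠⁽⁰⁾ → 𝔠⁽²⁾ with the constant majorant B₀e^{−δ₀d}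
  have h0 : HasMaj (BlockNorm.ofBlocks (toB6 g R₀ H₀) blk) (BlockNorm.ofBlocks (toB6 g R₀ H₀) blk) G0
      (fun a b => B₀ * g.len a ^ 2 * Real.exp (-(δ₀ * g.dist a b))) :=
    hasMaj_of_hasMajorant (g := toB6 g R₀ H₀) blk
      (fun a b => mul_nonneg (mul_nonneg hB₀ (sq_nonneg _)) (Real.exp_nonneg _)) he0
  have hS : HasMaj (cNorm R₀ H₀ blk hG.lenle 0) (cNorm R₀ H₀ blk hG.lenle 2) (G0 ∘ₗ LinearMap.id)
      (fun a b => B₀ * Real.exp (-(δ₀ * g.dist a b))) := by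
    rw [LinearMap.comp_id]
    refine (hasMaj_cNorm_of_hasMaj hG 2 0 h0).mono fun y y' => le_of_eq ?_
    have hy : g.len y ^ 2 ≠ 0 := pow_ne_zero 2 (hG.lenpos y).ne'
    simp only [wt, pow_zero, mul_one]
    rw [mul_assoc B₀, mul_comm (g.len y ^ 2), ← mul_assoc B₀, mul_assoc, mul_assoc, mul_inv_cancel₀ hy, mul_one]
  have h := hasMaj_right_of_step hG hrow hθ hB₀ hρ hρS hρδ hK hS hfix hq
  rw [LinearMap.comp_id] at h
  have h' := hasMajorantHom_of_hasMaj_cNorm hG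
    (fun a b => mul_nonneg (mul_nonneg hB₀ hq1) (Real.exp_nonneg _)) h
  rw [hasMajorantHom_iff] at h'
  refine hasMajorant_mono (g := toB6 g R₀ H₀) blk h' fun a b => le_of_eq ?_
  simp only [wt, pow_zero, inv_one, mul_one]
  ring

omit [Fintype Z] [Fintype W] in
/-- **THEOREM 3.12, ENTRY (3.42)₃ FOR G (OR G₁), PRINTED SHAPE**: from (3.42)₃ for G₀ (B₀L^jη·e^{−δ₀d} on bond sources),
the step majorant on 𝔠⁽¹⁾ and the resolvent identity: |(G∇*_UJ)(x)| ≦ B₀(1 − θc)⁻¹L^jη·e^{−ρd(y,y′)}|J| for x ∈ Δ(y),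
supp J ⊂ Δ(y′). [cite: Balaban1985BackgroundPropagators, Thm 3.12 p.423 + (3.42) p.397 + (3.130) p.421] -/
theorem entry2_of_step [Fintype Y] {R₀ : ℝ} {H₀ : Prop} (hG : GeoOK g) {blk : X → g.Site} {blkY : Y → g.Site}
    {G0 T A : Module.End ℝ (X → ℝ)} {Ds : (Y → ℝ) →ₗ[ℝ] (X → ℝ)}
    {θ B₀ δ₀ δK ρ σ c : ℝ} (hrow : RowSum (toB6 g R₀ H₀) σ c)
    (hθ : 0 ≤ θ) (hB₀ : 0 ≤ B₀) (hρ : 0 ≤ ρ) (hρS : ρ ≤ δ₀) (hρδ : ρ + σ ≤ δK)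
    (hK : HasMaj (cNorm R₀ H₀ blk hG.lenle 1) (cNorm R₀ H₀ blk hG.lenle 1) (G0 ∘ₗ T)
      (fun a b => θ * Real.exp (-(δK * g.dist a b))))
    (he2 : HasMajorantHom (g := toB6 g R₀ H₀) blkY blk (G0 ∘ₗ Ds)
      (fun a b => B₀ * g.len a * Real.exp (-(δ₀ * g.dist a b))))
    (hfix : A = G0 + G0 ∘ₗ T ∘ₗ A) (hq : θ * c < 1) :
    HasMajorantHom (g := toB6 g R₀ H₀) blkY blk (A ∘ₗ Ds)
      (fun a b => B₀ * (1 - θ * c)⁻¹ * g.len a * Real.exp (-(ρ * g.dist a b))) := by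
  have hq1 : 0 ≤ (1 - θ * c)⁻¹ := inv_nonneg.mpr (by linarith)
  have h0 : HasMaj (BlockNorm.ofBlocks (toB6 g R₀ H₀) blkY) (BlockNorm.ofBlocks (toB6 g R₀ H₀) blk) (G0 ∘ₗ Ds)
      (fun a b => B₀ * g.len a * Real.exp (-(δ₀ * g.dist a b))) :=
    hasMaj_of_hasMajorantHom (G := toB6 g R₀ H₀) blkY blk
      (fun a b => mul_nonneg (mul_nonneg hB₀ (hG.lenle a)) (Real.exp_nonneg _)) he2
  have hS : HasMaj (cNorm R₀ H₀ blkY hG.lenle 0) (cNorm R₀ H₀ blk hG.lenle 1) (G0 ∘ₗ Ds)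
      (fun a b => B₀ * Real.exp (-(δ₀ * g.dist a b))) := by
    refine (hasMaj_cNorm_of_hasMaj hG 1 0 h0).mono fun y y' => le_of_eq ?_
    have hy : g.len y ≠ 0 := (hG.lenpos y).ne'
    simp only [wt, pow_zero, pow_one, mul_one]
    rw [mul_assoc B₀, mul_comm (g.len y), ← mul_assoc B₀, mul_assoc, mul_inv_cancel₀ hy, mul_one]
  have h := hasMaj_right_of_step hG hrow hθ hB₀ hρ hρS hρδ hK hS hfix hq
  have h' := hasMajorantHom_of_hasMaj_cNorm hG
    (fun a b => mul_nonneg (mul_nonneg hB₀ hq1) (Real.exp_nonneg _)) h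
  refine hasMajorantHom_mono (g := toB6 g R₀ H₀) blkY blk h' fun a b => le_of_eq ?_
  simp only [wt, pow_zero, pow_one, inv_one, mul_one]
  ring

omit [Fintype Z] [Fintype W] in
/-- The remainder of the Neumann series in a block norm: if A₀ is a-priori bounded (constant majorant M₀ from `b₁` into
`b₂`) and K′ has θe^{−δd} on `b₂` with δ ≧ σ, then K′ᴺA₀ has the constant majorant (κ₂θc)ᴺM₀ (`B11SectG.hasMaj_comp_const`
iterated; the step (3) of `B11SectG.neumann_majorant`). [cite: Balaban1984PropagatorsII, (2.66) p.234] -/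
theorem hasMaj_pow_comp_const {G6 : B6.Geometry} {F₁ F₂ : Type} [AddCommGroup F₁] [Module ℝ F₁] [AddCommGroup F₂]
    [Module ℝ F₂] {b₁ : BlockNorm G6 F₁} {b₂ : BlockNorm G6 F₂} {K' : Module.End ℝ F₂} {A0 : F₁ →ₗ[ℝ] F₂}
    {θ M₀ δ σ c : ℝ} (hd : ∀ a b : G6.Site, 0 ≤ G6.dist a b) (hrow : RowSum G6 σ c) (hθ : 0 ≤ θ) (hM₀ : 0 ≤ M₀)
    (hσδ : σ ≤ δ) (hK : HasMaj b₂ b₂ K' (fun a b => θ * Real.exp (-(δ * G6.dist a b))))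
    (hap : HasMaj b₁ b₂ A0 (fun _ _ => M₀)) (N : ℕ) :
    HasMaj b₁ b₂ ((K' ^ N) ∘ₗ A0) (fun _ _ => (b₂.κ * θ * c) ^ N * M₀) := by
  induction N with
  | zero =>
      refine (hap.congr ?_).mono ?_
      · intro ν; simp
      · intro a b; simp
  | succ N ih =>
      have hq0 : 0 ≤ (b₂.κ * θ * c) ^ N * M₀ ∨ IsEmpty G6.Site := by
        by_cases hne : Nonempty G6.Site
        · exact Or.inl (mul_nonneg (pow_nonneg (mul_nonneg (mul_nonneg b₂.κ_nonneg hθ)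
            (hrow.nonneg (Classical.arbitrary _))) N) hM₀)
        · exact Or.inr (not_nonempty_iff.mp hne)
      rcases hq0 with hq0 | hemp
      swap
      · intro y' μ hμ y
        exact (IsEmpty.false y).elim
      have hstep := hasMaj_comp_const (b₁ := b₁) (b₂ := b₂) (b₃ := b₂) (T₁ := K') (T₂ := (K' ^ N) ∘ₗ A0)
        hd hrow hθ hq0 hσδ hK ih
      refine (hstep.congr fun ν => ?_).mono fun a b => le_of_eq ?_
      · simp [pow_succ', Module.End.mul_apply]
      · ring

omit [Fintype Z] [Fintype W] in
/-- **THE SERIES (3.130) ∕ (3.138) CONVERGES** (pointwise on the finite lattice): under the step majorant on some 𝔠⁽ᵖ⁾,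
the resolvent identity G = G₀ + G₀TG, the row sum (2.61) at a rate σ ≦ δ_K and the smallness θc < 1, the remainder
(G₀T)ᴺGf tends to 0 at every point, so Σ_{n<N}(G₀T)ⁿG₀f → Gf (`B11SectG.neumann_telescope`).  This is the content the pin
`HasRWExpOfOps` records for *"a convergence of the series (3.130), for α₀ sufficiently small"* (p. 422).
[cite: Balaban1985BackgroundPropagators, (3.130) p.421 + p.422 + (3.138) p.423] -/
theorem seriesConv_of_step {R₀ : ℝ} {H₀ : Prop} (hG : GeoOK g) {blk : X → g.Site} {G0 T A : Module.End ℝ (X → ℝ)}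
    {p : ℕ} {θ δK σ c : ℝ} (hrow : RowSum (toB6 g R₀ H₀) σ c) (hθ : 0 ≤ θ) (hσδ : σ ≤ δK)
    (hK : HasMaj (cNorm R₀ H₀ blk hG.lenle p) (cNorm R₀ H₀ blk hG.lenle p) (G0 ∘ₗ T)
      (fun a b => θ * Real.exp (-(δK * g.dist a b))))
    (hfix : A = G0 + G0 ∘ₗ T ∘ₗ A) (hq : θ * c < 1) : SeriesConv G0 T A := by
  classical
  intro f x
  set K' : Module.End ℝ (X → ℝ) := G0 ∘ₗ T with hK'
  have hfix' : A = G0 + K' ∘ₗ A := hfix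
  -- the remainder tends to zero, block piece by block piece
  obtain ⟨M₀, hM₀, hap⟩ := exists_hasMaj_const_cNorm R₀ H₀ hG blk blk (A ∘ₗ LinearMap.id) p 0
  rw [LinearMap.comp_id] at hap
  have hc0 : 0 ≤ c := hrow.nonneg (blk x)
  have hq0 : 0 ≤ θ * c := mul_nonneg hθ hc0
  set b₀ := cNorm R₀ H₀ blk hG.lenle 0 with hb₀
  set bF := cNorm R₀ H₀ blk hG.lenle p with hbF
  have hrem : ∀ N : ℕ, HasMaj b₀ bF ((K' ^ N) ∘ₗ A) (fun _ _ => (θ * c) ^ N * M₀) := by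
    intro N
    have h := hasMaj_pow_comp_const (b₁ := b₀) (b₂ := bF) hG.dnn hrow hθ hM₀ hσδ hK hap N
    simpa [hbF] using h
  have hpiece : ∀ y' : (toB6 g R₀ H₀).Site,
      Tendsto (fun N : ℕ => ((K' ^ N) (A (b₀.cut y' f))) x) atTop (𝓝 0) := by
    intro y'
    have hloc : b₀.IsLoc y' (b₀.cut y' f) := b₀.isLoc_cut y' f
    have hwt : 0 < wt g p (blk x) := wt_pos hG p (blk x)
    have hb : ∀ N : ℕ, |((K' ^ N) (A (b₀.cut y' f))) x| ≤
        (wt g p (blk x))⁻¹ * (M₀ * b₀.loc y' (b₀.cut y' f)) * (θ * c) ^ N := by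
      intro N
      have h1 := hrem N y' (b₀.cut y' f) hloc (blk x)
      simp only [LinearMap.comp_apply, hbF, cNorm, weightNorm_loc] at h1
      have h2 : |((K' ^ N) (A (b₀.cut y' f))) x| ≤
          (BlockNorm.ofBlocks (toB6 g R₀ H₀) blk).loc (blk x) ((K' ^ N) (A (b₀.cut y' f))) :=
        abs_apply_le_ofBlocks_loc (G := toB6 g R₀ H₀) blk (blk x) _ x rfl
      have h3 : |((K' ^ N) (A (b₀.cut y' f))) x| ≤
          (wt g p (blk x))⁻¹ * ((θ * c) ^ N * M₀ * b₀.loc y' (b₀.cut y' f)) :=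
        h2.trans ((le_inv_mul_iff₀ hwt).mpr h1)
      calc |((K' ^ N) (A (b₀.cut y' f))) x|
          ≤ (wt g p (blk x))⁻¹ * ((θ * c) ^ N * M₀ * b₀.loc y' (b₀.cut y' f)) := h3
        _ = (wt g p (blk x))⁻¹ * (M₀ * b₀.loc y' (b₀.cut y' f)) * (θ * c) ^ N := by ring
    have hlim : Tendsto (fun N : ℕ => (wt g p (blk x))⁻¹ * (M₀ * b₀.loc y' (b₀.cut y' f)) * (θ * c) ^ N) atTop
        (𝓝 ((wt g p (blk x))⁻¹ * (M₀ * b₀.loc y' (b₀.cut y' f)) * 0)) :=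
      (tendsto_pow_atTop_nhds_zero_of_lt_one hq0 hq).const_mul _
    rw [mul_zero] at hlim
    exact squeeze_zero_norm (fun N => by simpa only [Real.norm_eq_abs] using hb N) hlim
  have hremf : Tendsto (fun N : ℕ => ((K' ^ N) (A f)) x) atTop (𝓝 0) := by
    have heq : (fun N : ℕ => ((K' ^ N) (A f)) x) =
        fun N => ∑ y' : (toB6 g R₀ H₀).Site, ((K' ^ N) (A (b₀.cut y' f))) x := by
      funext N
      conv_lhs => rw [← b₀.sum_cut f]
      simp only [map_sum, Finset.sum_apply]
    rw [heq]
    simpa using tendsto_finsetSum _ fun y' _ => hpiece y'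
  -- the partial sums are Gf minus the remainder
  have htel : ∀ N : ℕ, (∑ n ∈ Finset.range N, (K' ^ n) (G0 f)) x = A f x - ((K' ^ N) (A f)) x := by
    intro N
    have h := congrFun (neumann_telescope hfix' N f) x
    rw [Pi.add_apply] at h
    linarith
  show Tendsto (fun N : ℕ => (∑ n ∈ Finset.range N, (K' ^ n) (G0 f)) x) atTop (𝓝 (A f x))
  simp_rw [htel]
  have hlim := (tendsto_const_nhds (x := A f x)).sub hremf
  rw [sub_zero] at hlim
  exact hlim

/-- **THEOREM 3.11 FOR G (OR G₁) FROM THE FORM BOUND** (the Theorem-3.11 clause of Theorem 3.12, `B9SectDForm` Lemma D at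
operator level): Δ_a positive definite, |⟨f, Tf⟩| ≦ r⟨f, Δ_af⟩ with r < 1 and (Δ_a − T)A = I ⇒ A positive definite
(⟨f, Af⟩ = ⟨(Δ_a − T)g, g⟩ ≧ (1 − r)⟨g, Δ_ag⟩ > 0 with g = Af ≠ 0). [cite: Balaban1985BackgroundPropagators, Thm 3.12 p.423 + Thm 3.11 p.416] -/
theorem posDef_of_formSmall {S T A : Module.End ℝ (X → ℝ)} {r : ℝ} (hr : r < 1) (hpos : PosDefEnd S)
    (hsmall : ∀ f : X → ℝ, |f ⬝ᵥ T f| ≤ r * (f ⬝ᵥ S f)) (hinv : (S - T) * A = 1) : PosDefEnd A := by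
  intro f hf
  set h : X → ℝ := A f with hh
  have hg : (S - T) h = f := by
    have := congrArg (fun L : Module.End ℝ (X → ℝ) => L f) hinv
    simpa [Module.End.mul_apply] using this
  have hne : h ≠ 0 := by
    intro h0
    apply hf
    rw [← hg, h0, map_zero]
  have hS := hpos h hne
  have hT : h ⬝ᵥ T h ≤ r * (h ⬝ᵥ S h) := (le_abs_self _).trans (hsmall h)
  calc (0 : ℝ) < (1 - r) * (h ⬝ᵥ S h) := mul_pos (by linarith) hS
    _ ≤ h ⬝ᵥ S h - h ⬝ᵥ T h := by nlinarith
    _ = (S - T) h ⬝ᵥ h := by rw [LinearMap.sub_apply, sub_dotProduct, dotProduct_comm h (S h), dotProduct_comm h (T h)]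
    _ = f ⬝ᵥ A f := by rw [hg]

omit [Fintype g.Site] in
/-- p. 425, **Q𝔓 = 0** from (QG₁Q*)(QG₁Q*)⁻¹ = I and QG₁DR = 0 (twin of `B9FrakGPos.q_comp_frakP`). [cite: Balaban1985BackgroundPropagators, p.425] -/
theorem Q_frakP {𝔬 : Ops g B X Y Z W} {U : B.Cfg} (hI : Identities 𝔬 U) (f : X → ℝ) : 𝔬.Q U (frakP 𝔬 U f) = 0 := by
  have h1 : 𝔬.Q U (𝔬.G1 U (𝔬.Qstar U (𝔬.C1 U (𝔬.Q U f)))) = 𝔬.Q U f := by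
    simpa using LinearMap.congr_fun hI.c1_inv (𝔬.Q U f)
  have h2 : 𝔬.Q U (𝔬.G1 U (𝔬.Dv U (𝔬.R U (𝔬.Dvstar U f)))) = 0 := by
    simpa using LinearMap.congr_fun hI.h124Q (𝔬.Dvstar U f)
  simp [frakP_apply, map_sub, h1, h2]

omit [Fintype g.Site] in
/-- p. 425, **RD*𝔓 = 0** from RD*G₁Q* = 0 and RD*G₁DR = R (twin of `B9FrakGPos.rds_comp_frakP`). [cite: Balaban1985BackgroundPropagators, p.425] -/
theorem RDs_frakP {𝔬 : Ops g B X Y Z W} {U : B.Cfg} (hI : Identities 𝔬 U) (f : X → ℝ) :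
    𝔬.R U (𝔬.Dvstar U (frakP 𝔬 U f)) = 0 := by
  have h1 : 𝔬.R U (𝔬.Dvstar U (𝔬.G1 U (𝔬.Qstar U (𝔬.C1 U (𝔬.Q U f))))) = 0 := by
    simpa using LinearMap.congr_fun hI.h124R (𝔬.C1 U (𝔬.Q U f))
  have h2 : 𝔬.R U (𝔬.Dvstar U (𝔬.G1 U (𝔬.Dv U (𝔬.R U (𝔬.Dvstar U f))))) = 𝔬.R U (𝔬.Dvstar U f) := by
    simpa using LinearMap.congr_fun hI.hR (𝔬.Dvstar U f)
  simp [frakP_apply, map_sub, h1, h2]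

omit [Fintype g.Site] in
/-- 𝔊f = 𝔓(G₁f) under (3.153). [cite: Balaban1985BackgroundPropagators, (3.153) p.426] -/
theorem GG_apply {𝔬 : Ops g B X Y Z W} {U : B.Cfg} (hI : Identities 𝔬 U) (f : X → ℝ) :
    𝔬.GG U f = frakP 𝔬 U (𝔬.G1 U f) := by
  have h := LinearMap.congr_fun (G1_comp_frakPstar 𝔬 U) f
  rw [hI.eq153]
  exact h

omit [Fintype g.Site] in
/-- **THE MECHANISM ⟨f, 𝔊f⟩ = ⟨𝔓*f, G₁𝔓*f⟩** (dot-product twin of `B9FrakGPos.inner_frakG_eq`): from Q* ∕ D* adjoint to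
Q ∕ D, R symmetric and the four identities of p. 425. [cite: Balaban1985BackgroundPropagators, (3.153) p.426 + p.425] -/
theorem dot_GG_eq {𝔬 : Ops g B X Y Z W} {U : B.Cfg} (hI : Identities 𝔬 U) (f : X → ℝ) :
    f ⬝ᵥ 𝔬.GG U f = frakPstar 𝔬 U f ⬝ᵥ 𝔬.G1 U (frakPstar 𝔬 U f) := by
  have hQ : 𝔬.Q U (𝔬.GG U f) = 0 := by rw [GG_apply hI]; exact Q_frakP hI _
  have hRD : 𝔬.R U (𝔬.Dvstar U (𝔬.GG U f)) = 0 := by rw [GG_apply hI]; exact RDs_frakP hI _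
  have e : f = frakPstar 𝔬 U f + 𝔬.Qstar U (𝔬.C1 U (𝔬.Q U (𝔬.G1 U f))) +
      𝔬.Dv U (𝔬.R U (𝔬.Dvstar U (𝔬.G1 U f))) := by
    rw [frakPstar_apply]; abel
  have t1 : 𝔬.Qstar U (𝔬.C1 U (𝔬.Q U (𝔬.G1 U f))) ⬝ᵥ 𝔬.GG U f = 0 := by
    rw [dotProduct_comm, ← hI.adjQ, hQ, zero_dotProduct]
  have t2 : 𝔬.Dv U (𝔬.R U (𝔬.Dvstar U (𝔬.G1 U f))) ⬝ᵥ 𝔬.GG U f = 0 := by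
    rw [hI.adjDv, hI.symmR, hRD, dotProduct_zero]
  have hGG : 𝔬.GG U f = 𝔬.G1 U (frakPstar 𝔬 U f) := by
    rw [hI.eq153]; rfl
  calc f ⬝ᵥ 𝔬.GG U f
      = (frakPstar 𝔬 U f + 𝔬.Qstar U (𝔬.C1 U (𝔬.Q U (𝔬.G1 U f))) +
          𝔬.Dv U (𝔬.R U (𝔬.Dvstar U (𝔬.G1 U f)))) ⬝ᵥ 𝔬.GG U f := by rw [← e]
    _ = frakPstar 𝔬 U f ⬝ᵥ 𝔬.GG U f := by rw [add_dotProduct, add_dotProduct, t1, t2, add_zero, add_zero]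
    _ = frakPstar 𝔬 U f ⬝ᵥ 𝔬.G1 U (frakPstar 𝔬 U f) := by rw [hGG]

omit [Fintype g.Site] in
/-- **𝔊 ≥ 0** when G₁ is positive definite (twin of `B9FrakGPos.inner_frakG_nonneg`). [cite: Balaban1985BackgroundPropagators, Thm 3.13 p.426 + (3.153) p.426] -/
theorem GG_nonneg {𝔬 : Ops g B X Y Z W} {U : B.Cfg} (hI : Identities 𝔬 U) (hG1 : PosDefEnd (𝔬.G1 U)) (f : X → ℝ) :
    0 ≤ f ⬝ᵥ 𝔬.GG U f := by
  rw [dot_GG_eq hI]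
  exact hG1.nonneg _

omit [Fintype g.Site] in
/-- **THE REPAIRED CLAUSE «THEOREM 3.11 HOLDS FOR 𝔊»** (twin of `B9FrakGPos.frakG_pos_on_constraint`): on {A : QA = 0,
RD*A = 0} — the surface of the defining integral (3.148) — the form of 𝔊 is positive definite when G₁ is.
[cite: Balaban1985BackgroundPropagators, Thm 3.13 p.426 + (3.148) p.425 + (3.153) p.426] -/
theorem GG_pos_on_constraint {𝔬 : Ops g B X Y Z W} {U : B.Cfg} (hI : Identities 𝔬 U) (hG1 : PosDefEnd (𝔬.G1 U))
    (f : X → ℝ) (hQf : 𝔬.Q U f = 0) (hRf : 𝔬.R U (𝔬.Dvstar U f) = 0) (hf : f ≠ 0) : 0 < f ⬝ᵥ 𝔬.GG U f := by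
  rw [dot_GG_eq hI]
  refine hG1 _ fun h0 => hf ?_
  have e : f = 𝔬.Qstar U (𝔬.C1 U (𝔬.Q U (𝔬.G1 U f))) + 𝔬.Dv U (𝔬.R U (𝔬.Dvstar U (𝔬.G1 U f))) := by
    rw [frakPstar_apply, sub_sub, sub_eq_zero] at h0; exact h0
  have hff : f ⬝ᵥ f = 0 := by
    calc f ⬝ᵥ f = f ⬝ᵥ (𝔬.Qstar U (𝔬.C1 U (𝔬.Q U (𝔬.G1 U f))) + 𝔬.Dv U (𝔬.R U (𝔬.Dvstar U (𝔬.G1 U f)))) := by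
          rw [← e]
      _ = 0 := by
          rw [dotProduct_add, ← hI.adjQ, hQf, zero_dotProduct, zero_add, dotProduct_comm, hI.adjDv, hI.symmR, hRf,
            dotProduct_zero]
  exact dotProduct_self_eq_zero.mp hff

omit [Fintype g.Site] in
/-- **THE PIN `PosDefKOfOps` INHABITED**: the form bound with r < 1 (for Δ′_π and for Δ′_π + Δ⁽²⁾_π), Theorem 3.11 for Δ_a
and the identities give G, G₁ > 0, 𝔊 ≥ 0 and 𝔊 > 0 on the constraint subspace — for EVERY kernel-family argument.
[cite: Balaban1985BackgroundPropagators, Thm 3.12 p.423 + Thm 3.13 p.426 + Thm 3.11 p.416] -/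
theorem posDefK_of_schemas {𝔬 : Ops g B X Y Z W} {U : B.Cfg} {r : ℝ} (hr : r < 1) (hF : FormSmall 𝔬 r U)
    (hI : Identities 𝔬 U) (K : B9.KernelFamily g B) : PosDefKOfOps 𝔬 K U := by
  have hG : PosDefEnd (𝔬.G U) := posDef_of_formSmall hr hF.posS0 hF.small hI.invG
  have hG1 : PosDefEnd (𝔬.G1 U) := posDef_of_formSmall hr hF.posS0 hF.small1 hI.invG1
  exact ⟨hG, hG1, GG_nonneg hI hG1, GG_pos_on_constraint hI hG1⟩

omit [Fintype Z] [Fintype W] in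
/-- A pointwise-convergent sequence of lattice functions stays convergent after a linear map of the finite lattice
(expand in the representing matrix). [folklore] -/
private theorem tendsto_apply_linearMap [DecidableEq X] (L : Module.End ℝ (X → ℝ)) {s : ℕ → X → ℝ} {t : X → ℝ}
    (h : ∀ x : X, Tendsto (fun N => s N x) atTop (𝓝 (t x))) (x : X) :
    Tendsto (fun N => L (s N) x) atTop (𝓝 (L t x)) := by
  have hrep : ∀ u : X → ℝ, L u x = ∑ x', LinearMap.toMatrix' L x x' * u x' := fun u => (sum_toMatrix'_mul L u x).symm
  simp_rw [hrep]
  exact tendsto_finsetSum _ fun x' _ => (h x').const_mul _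

/-- **THE PIN `HasRWExpOfOps` INHABITED**: the step majorants on 𝔠⁽ᵖ⁾ for K′ = G₀Δ′_π and K′₁ = G₀(Δ′_π + Δ⁽²⁾_π), the row
sum (2.61) at rate σ ≦ δ_K, the smallness θc < 1 and the identities give the convergence of (3.130) to G, of (3.138) to G₁
and of 𝔓·(3.138) to 𝔊 = 𝔓G₁ — for EVERY kernel-family and rate argument.
[cite: Balaban1985BackgroundPropagators, Thm 3.12 p.423 + (3.130) p.421 + (3.138) p.423 + (3.153) p.426] -/
theorem hasRWExp_of_schemas [DecidableEq X] {R₀ : ℝ} {H₀ : Prop} (hG : GeoOK g) {𝔬 : Ops g B X Y Z W} {U : B.Cfg}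
    {p : ℕ} {θ δK σ c : ℝ} (hrow : RowSum (toB6 g R₀ H₀) σ c) (hθ : 0 ≤ θ) (hσδ : σ ≤ δK) (hq : θ * c < 1)
    (hS : Step 𝔬 R₀ H₀ hG.lenle p θ δK U) (hI : Identities 𝔬 U) (K : B9.KernelFamily g B) (δ : ℝ) :
    HasRWExpOfOps 𝔬 K U δ := by
  have hfix := fix_of_inverses hI.invG0' hI.invG
  have hfix1 := fix_of_inverses hI.invG0' hI.invG1
  have h1 : SeriesConv (𝔬.G0 U) (𝔬.Tpi U) (𝔬.G U) := seriesConv_of_step hG hrow hθ hσδ hS.step hfix hq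
  have h2 : SeriesConv (𝔬.G0 U) (𝔬.Tpi U + 𝔬.T2 U) (𝔬.G1 U) := seriesConv_of_step hG hrow hθ hσδ hS.step1 hfix1 hq
  refine ⟨h1, h2, fun f x => ?_⟩
  have h3 := tendsto_apply_linearMap (frakP 𝔬 U) (fun x' => h2 f x') x
  have h4 : frakP 𝔬 U (𝔬.G1 U f) x = 𝔬.GG U f x := by rw [GG_apply hI]
  rw [h4] at h3
  simpa only [LinearMap.id_coe, id_eq] using h3

/-- **THE PIN `HasRWExpHOfOps` INHABITED**: H = GQ*(QGQ*)⁻¹, H₁ = G₁Q*(QG₁Q*)⁻¹ ((3.126), (3.129)) and the convergence of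
(3.130), (3.138) give the convergence of the inserted series to H, H₁ — for EVERY H-kernel and rate argument.
[cite: Balaban1985BackgroundPropagators, Thm 3.12 p.423 + (3.126) p.420 + (3.129) p.421] -/
theorem hasRWExpH_of_schemas [DecidableEq X] {R₀ : ℝ} {H₀ : Prop} (hG : GeoOK g) {𝔬 : Ops g B X Y Z W} {U : B.Cfg}
    {p : ℕ} {θ δK σ c : ℝ} (hrow : RowSum (toB6 g R₀ H₀) σ c) (hθ : 0 ≤ θ) (hσδ : σ ≤ δK) (hq : θ * c < 1)
    (hS : Step 𝔬 R₀ H₀ hG.lenle p θ δK U) (hI : Identities 𝔬 U) (Hk : B9.HKernel g B) (δ : ℝ) :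
    HasRWExpHOfOps 𝔬 Hk U δ := by
  have hfix := fix_of_inverses hI.invG0' hI.invG
  have hfix1 := fix_of_inverses hI.invG0' hI.invG1
  have h1 : SeriesConv (𝔬.G0 U) (𝔬.Tpi U) (𝔬.G U) := seriesConv_of_step hG hrow hθ hσδ hS.step hfix hq
  have h2 : SeriesConv (𝔬.G0 U) (𝔬.Tpi U + 𝔬.T2 U) (𝔬.G1 U) := seriesConv_of_step hG hrow hθ hσδ hS.step1 hfix1 hq
  refine ⟨fun b x => ?_, fun b x => ?_⟩
  · have h := h1 (𝔬.Qstar U (𝔬.C U b)) x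
    rw [hI.eq126]
    simpa using h
  · have h := h2 (𝔬.Qstar U (𝔬.C1 U b)) x
    rw [hI.eq129]
    simpa using h


/-! ## §4½ Bookkeeping of the typed blocks (assembly without the Laplacian entry; weakening of (3.133)) -/

variable {P : g.Loc → Prop}

omit [Fintype X] [Fintype Z] [Fintype W] [Fintype g.Site] in
/-- The sup part of `B9.Ineq342_346_347_noLap` from the three clauses n = 0, 1, 2 (Theorem 3.12's exception: no n = 3).
[cite: Balaban1985BackgroundPropagators, Thm 3.12 p.423 + (3.42) p.397] -/
theorem eNoLap_of_clauses {K : B9.KernelFamily g B} {B₀ δ₀ : ℝ} {U : B.Cfg} (h0 : Clause342 K 0 B₀ δ₀ U)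
    (h1 : Clause342 K 1 B₀ δ₀ U) (h2 : Clause342 K 2 B₀ δ₀ U) :
    ∀ (n : Fin 4) (lam : g.Loc) (y y' : g.Site), n ≠ 3 → g.suppIn lam y' →
      K.e n U lam y ≤ B₀ * B9.pref4 (g.len y) n * Real.exp (-(δ₀ * g.dist y y')) * g.supNorm lam := by
  intro n lam y y' hn hs
  fin_cases n
  · exact h0 lam y y' hs
  · exact h1 lam y y' hs
  · exact h2 lam y y' hs
  · exact absurd rfl hn

omit [Fintype X] [Fintype Z] [Fintype W] [Fintype g.Site] in
/-- «Of course with different constants» for (3.133): C ≦ C′, δ′ ≦ δ under the sign facts ((L^jη)^{−n}, (L^{j′}η)^{−d},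
‖ζ‖ + |ζ| ≧ 0, C(β) ≧ 0). [cite: Balaban1985BackgroundPropagators, (3.133) p.422 + p.423] -/
theorem ineq3133_mono (S : ModelSignsOn g P) (d : ℕ) {Hk : B9.HKernel g B} {C C' : ℝ} {Cβ : ℝ → ℝ} {δ δ' : ℝ}
    {U : B.Cfg} (h : B9.Ineq3133 d Hk C Cβ δ U) (hC : C ≤ C') (hC' : 0 ≤ C') (hCβ : ∀ β, 0 ≤ Cβ β)
    (hδ : δ' ≤ δ) : B9.Ineq3133 d Hk C' Cβ δ' U := by
  refine ⟨fun n y y' => ?_, fun β ζ y y' h0 h1 hζ => ?_⟩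
  · have h1 : Hk.e n U y y' ≤ C * (g.len y) ^ (-(n : ℝ)) * (g.len y') ^ (-(d : ℝ)) *
        Real.exp (-(δ / 2 * g.dist y y')) * 1 := by rw [mul_one]; exact h.1 n y y'
    have h2 := weaken5 h1 hC hC' (Real.rpow_nonneg (S.len_nonneg y) _) (Real.rpow_nonneg (S.len_nonneg y') _)
      zero_le_one (by linarith : δ' / 2 ≤ δ / 2) (S.dist_nonneg y y')
    rw [mul_one] at h2
    exact h2
  · refine (h.2 β ζ y y' h0 h1 hζ).trans ?_
    have hnn : 0 ≤ Cβ β * g.cutH β ζ * (g.len y) ^ (-(1 + β)) * (g.len y') ^ (-(d : ℝ)) :=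
      mul_nonneg (mul_nonneg (mul_nonneg (hCβ β) (S.cutH_nonneg β ζ)) (Real.rpow_nonneg (S.len_nonneg y) _))
        (Real.rpow_nonneg (S.len_nonneg y') _)
    exact mul_le_mul_of_nonneg_left (decay_mono (by linarith : δ' / 2 ≤ δ / 2) (S.dist_nonneg y y')) hnn

omit [Fintype X] [Fintype Z] [Fintype W] [Fintype g.Site] in
/-- Arithmetic of *"for α₀ sufficiently small"*: t ≧ 0 and m ≦ (2(t + 1))⁻¹ give tm ≦ ½. [folklore] -/
private theorem small_aux {t m : ℝ} (ht : 0 ≤ t) (hm : m ≤ (2 * (t + 1))⁻¹) : t * m ≤ 1 / 2 := by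
  have hpos : 0 < 2 * (t + 1) := by linarith
  have h1 : t * m ≤ t * (2 * (t + 1))⁻¹ := mul_le_mul_of_nonneg_left hm ht
  have h2 : t * (2 * (t + 1))⁻¹ ≤ 1 / 2 := by
    rw [← div_eq_mul_inv, div_le_iff₀ hpos]
    linarith
  linarith

end OneMember

/-! ## §5 The family: the whole printed leaf `B9.Thm312Printed` at the pins -/

section Family

variable {I : Type} {d : ℕ} {c35 : ℝ} {geo : I → B9.Geometry} {bg : I → B9.Backgrounds}
variable [∀ i, Fintype (geo i).Site]
variable {X Y Z W : I → Type} [∀ i, Fintype (X i)] [∀ i, DecidableEq (X i)] [∀ i, Fintype (Y i)]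
  [∀ i, Fintype (Z i)] [∀ i, Fintype (W i)]

/-- ★ **THEOREM 3.12 AS THE WHOLE PRINTED LEAF `B9.Thm312Printed`, AT THE PINS** (p. 423: *"If an external gauge field
configuration U satisfies both regularity conditions (3.35), (3.36) for α₀ sufficiently small, then Theorems 3.3, 3.10, 3.11
hold for the propagators G, G₁, with one exception and the inequality (3.133) together with Theorem 3.10 hold for the
operators H, H₁"*), for FREE kernel families `GD G₁` and H-kernels `Hk H₁k` (the field types of `OperatorLayerY`) whose sup
entries n = 0, 2 are CO-READ by the model operators G(U), G(U)∇*_U, G₁(U), G₁(U)∇*_U of the letter record (`CoRealizes`, the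
reading hypothesis `hco`), with `HasRWExp := HasRWExpOfOps (𝔬 i)`, `HasRWExpH := HasRWExpHOfOps (𝔬 i)`, `PosDefK :=
PosDefKOfOps (𝔬 i)`.  INPUTS, per member and per U under the printed provisos (M ≧ M₁, 0 < α₀, Mα₀ ≦ a₁, (3.35), (3.36)):
Theorem 3.3 for G₀ (`Thm33G0`), the perturbation steps on 𝔠⁽¹⁾ and 𝔠⁽²⁾ with constant θ₁·(Mα₀) at rate δ_K (`Step`), the form
bound with constant r₁·(Mα₀) and Theorem 3.11 for Δ_a (`FormSmall`), the identities (`Identities`); per member: the static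
geometry (`GeoOK`), the sign facts (`ModelSignsOn (geo i) (P i)`, any `P`), [4] Lemma 2.1 (2.61) as a row sum at rate σ with
constant c for M ≧ M_L; rates 0 < ρ ≦ δ₀, ρ + σ ≦ δ_K; AND THE RESIDUAL MEMBERS DISPLAYED (`hres`, constants B₁, δ₁, B(β),
B′(ε), B′(ε,β) before i): the left sup entry (3.42)₂, the L² block (3.46), the global entries (3.47)₁₋₃ and the Hölder block
(3.43)–(3.45) for G and G₁, and (3.133) for H, H₁ — NOT proved here (routes: `B9SectDSup` THEOREM S for (3.42)₂ ∕ (3.43)–(3.45)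
∕ (3.47), `B9SectDL2Decay` for (3.46), `B9Ineq3133Assembly` for (3.133)).  PROVED INSIDE: (3.42)₁,₃ for G and G₁ with the
constant 2B₀ at rate ρ (`entry0_of_step`, `entry2_of_step`, q = θ₁(Mα₀)c ≦ ½), Theorem 3.11 for G, G₁ and the repaired
clause for 𝔊 (`posDefK_of_schemas`), the convergence of (3.130), (3.138) and of the inserted series for 𝔊, H, H₁
(`hasRWExp_of_schemas`, `hasRWExpH_of_schemas`).  The printed quantifiers are met with M₄ := max(M₁, M_L), a₀ := min(a₁,
(2(θ₁c + 1))⁻¹, (2(r₁ + 1))⁻¹), δ₀ := min(ρ, δ₁), B₀ := max(2B₀, B₁, 1).  Nothing of print asserted; NOT a node discharge.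
[cite: Balaban1985BackgroundPropagators, Thm 3.12 pp.421–423 + (3.130) p.421 + (3.138) p.423 + (3.126) p.420 + (3.153) p.426; Balaban1984PropagatorsII, Lemma 2.1 (2.61) p.234] -/
theorem thm312Printed_of_step (𝔬 : ∀ i, Ops (geo i) (bg i) (X i) (Y i) (Z i) (W i)) (R₀ : I → ℝ) (H₀ : I → Prop)
    (GD G₁ : ∀ i, B9.KernelFamily (geo i) (bg i)) (Hk H₁k : ∀ i, B9.HKernel (geo i) (bg i))
    (ev : ∀ i, (geo i).Loc → X i → ℝ) (evY : ∀ i, (geo i).Loc → Y i → ℝ) {P : ∀ i, (geo i).Loc → Prop}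
    (θ₁ r₁ B₀ δ₀ δK σ c ρ a₁ M₁ ML B₁ δ₁ : ℝ) (Bβ Bε : ℝ → ℝ) (Bεβ : ℝ → ℝ → ℝ)
    (hθ₁ : 0 ≤ θ₁) (hr₁ : 0 ≤ r₁) (hB₀ : 0 ≤ B₀) (hρ : 0 < ρ) (hρS : ρ ≤ δ₀) (hρδ : ρ + σ ≤ δK) (hc : 0 ≤ c)
    (ha₁ : 0 < a₁) (hM₁ : 0 < M₁) (hB₁ : 0 ≤ B₁) (hδ₁ : 0 < δ₁) (hBβ : ∀ β, 0 ≤ Bβ β) (hBε : ∀ ε, 0 ≤ Bε ε)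
    (hBεβ : ∀ ε β, 0 ≤ Bεβ ε β)
    (hgeo : ∀ i, GeoOK (geo i)) (S : ∀ i, ModelSignsOn (geo i) (P i))
    (hrow : ∀ i, ML ≤ (geo i).M → RowSum (toB6 (geo i) (R₀ i) (H₀ i)) σ c)
    (hco : ∀ (i : I) (U : (bg i).Cfg),
      CoRealizes (GD i) 0 U (𝔬 i).blk (𝔬 i).blk (ev i) ((𝔬 i).G U) ∧
      CoRealizes (GD i) 2 U (𝔬 i).blk (𝔬 i).blkY (evY i) ((𝔬 i).G U ∘ₗ (𝔬 i).Dstar U) ∧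
      CoRealizes (G₁ i) 0 U (𝔬 i).blk (𝔬 i).blk (ev i) ((𝔬 i).G1 U) ∧
      CoRealizes (G₁ i) 2 U (𝔬 i).blk (𝔬 i).blkY (evY i) ((𝔬 i).G1 U ∘ₗ (𝔬 i).Dstar U))
    (hmodel : ∀ i, M₁ ≤ (geo i).M → ∀ α₀ : ℝ, 0 < α₀ → (geo i).M * α₀ ≤ a₁ →
      ∀ U : (bg i).Cfg, (bg i).Reg335 c35 α₀ U → (bg i).Reg336 c35 α₀ U →
        Thm33G0 (𝔬 i) (R₀ i) (H₀ i) B₀ δ₀ U ∧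
        Step (𝔬 i) (R₀ i) (H₀ i) (hgeo i).lenle 1 (θ₁ * ((geo i).M * α₀)) δK U ∧
        Step (𝔬 i) (R₀ i) (H₀ i) (hgeo i).lenle 2 (θ₁ * ((geo i).M * α₀)) δK U ∧
        FormSmall (𝔬 i) (r₁ * ((geo i).M * α₀)) U ∧ Identities (𝔬 i) U)
    (hres : ∀ i, M₁ ≤ (geo i).M → ∀ α₀ : ℝ, 0 < α₀ → (geo i).M * α₀ ≤ a₁ →
      ∀ U : (bg i).Cfg, (bg i).Reg335 c35 α₀ U → (bg i).Reg336 c35 α₀ U →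
        (∀ K ∈ [GD i, G₁ i], Clause342 K 1 B₁ δ₁ U ∧ L2Block K B₁ δ₁ U ∧
          (∀ (n : Fin 4) (lam : (geo i).Loc) (γ : ℝ), n ≠ 3 → -4 ≤ γ → γ ≤ 4 →
            K.glob n U lam γ ≤ B₁ * (geo i).wNorm γ lam) ∧
          B9.Ineq343_345 K Bβ Bε Bεβ δ₁ U) ∧
        (∀ Hk' ∈ [Hk i, H₁k i], B9.Ineq3133 d Hk' B₁ Bβ δ₁ U)) :
    B9.Thm312Printed d c35 geo bg GD G₁ Hk H₁k (fun i => HasRWExpOfOps (𝔬 i)) (fun i => HasRWExpHOfOps (𝔬 i))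
      (fun i => PosDefKOfOps (𝔬 i)) := by
  -- the constants of the leaf
  set a₀ : ℝ := min a₁ (min (2 * (θ₁ * c + 1))⁻¹ (2 * (r₁ + 1))⁻¹) with ha₀
  set Bout : ℝ := max (max (2 * B₀) B₁) 1 with hBout
  set δout : ℝ := min ρ δ₁ with hδout
  have ha₀pos : 0 < a₀ := lt_min ha₁ (lt_min (inv_pos.mpr (by nlinarith)) (inv_pos.mpr (by linarith)))
  have hBout1 : 2 * B₀ ≤ Bout := (le_max_left _ _).trans (le_max_left _ _)
  have hBoutB₁ : B₁ ≤ Bout := (le_max_right _ _).trans (le_max_left _ _)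
  have hBout0 : 0 ≤ Bout := zero_le_one.trans (le_max_right _ _)
  have hδρ : δout ≤ ρ := min_le_left _ _
  have hδδ₁ : δout ≤ δ₁ := min_le_right _ _
  refine ⟨max M₁ ML, δout, a₀, Bout, Bβ, Bε, Bεβ, lt_max_of_lt_left hM₁, lt_min hρ hδ₁, ha₀pos,
    zero_lt_one.trans_le (le_max_right _ _), ?_⟩
  intro i hM α₀ hα₀ hMa U hU hU'
  have hM₁i : M₁ ≤ (geo i).M := (le_max_left _ _).trans hM
  have hMLi : ML ≤ (geo i).M := (le_max_right _ _).trans hM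
  have hMpos : 0 < (geo i).M := hM₁.trans_le hM₁i
  have hm0 : 0 ≤ (geo i).M * α₀ := (mul_pos hMpos hα₀).le
  have hma₁ : (geo i).M * α₀ ≤ a₁ := hMa.trans (min_le_left _ _)
  have hmθ : (geo i).M * α₀ ≤ (2 * (θ₁ * c + 1))⁻¹ := hMa.trans ((min_le_right _ _).trans (min_le_left _ _))
  have hmr : (geo i).M * α₀ ≤ (2 * (r₁ + 1))⁻¹ := hMa.trans ((min_le_right _ _).trans (min_le_right _ _))
  obtain ⟨h33, hS1, hS2, hF, hI⟩ := hmodel i hM₁i α₀ hα₀ hma₁ U hU hU'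
  obtain ⟨hresK, hresH⟩ := hres i hM₁i α₀ hα₀ hma₁ U hU hU'
  have hrowi := hrow i hMLi
  set θ : ℝ := θ₁ * ((geo i).M * α₀) with hθdef
  have hθ : 0 ≤ θ := mul_nonneg hθ₁ hm0
  have hq : θ * c ≤ 1 / 2 := by
    have h := small_aux (mul_nonneg hθ₁ hc) hmθ
    calc θ * c = θ₁ * c * ((geo i).M * α₀) := by rw [hθdef]; ring
      _ ≤ 1 / 2 := h
  have hq1 : θ * c < 1 := lt_one_of_le_half hq
  have hr : r₁ * ((geo i).M * α₀) < 1 := by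
    have h := small_aux hr₁ hmr
    linarith
  have hσδ : σ ≤ δK := by linarith
  have hCle : B₀ * (1 - θ * c)⁻¹ ≤ Bout := (const_le_two_mul hB₀ hq).trans hBout1
  have hC0 : 0 ≤ B₀ * (1 - θ * c)⁻¹ := mul_nonneg hB₀ (inv_nonneg.mpr (by linarith))
  have hfix := fix_of_inverses hI.invG0' hI.invG
  have hfix1 := fix_of_inverses hI.invG0' hI.invG1
  obtain ⟨hcoG0, hcoG2, hcoG10, hcoG12⟩ := hco i U
  have hlen := (hgeo i).lenle
  -- the proved clauses, brought to (Bout, δout)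
  have clG0 : Clause342 (GD i) 0 Bout δout U :=
    clause342_mono (clause342_e0_of_hasMajorant hcoG0
      (entry0_of_step (hgeo i) hrowi hθ hB₀ hρ.le hρS hρδ hS2.step h33.e0 hfix hq1) hC0 hlen)
      hC0 hCle hδρ (S i).dist_nonneg hlen (S i).supNorm_nonneg
  have clG2 : Clause342 (GD i) 2 Bout δout U :=
    clause342_mono (clause342_e2_of_hasMajorantHom hcoG2
      (entry2_of_step (hgeo i) hrowi hθ hB₀ hρ.le hρS hρδ hS1.step h33.e2 hfix hq1) hC0 hlen)
      hC0 hCle hδρ (S i).dist_nonneg hlen (S i).supNorm_nonneg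
  have clG10 : Clause342 (G₁ i) 0 Bout δout U :=
    clause342_mono (clause342_e0_of_hasMajorant hcoG10
      (entry0_of_step (hgeo i) hrowi hθ hB₀ hρ.le hρS hρδ hS2.step1 h33.e0 hfix1 hq1) hC0 hlen)
      hC0 hCle hδρ (S i).dist_nonneg hlen (S i).supNorm_nonneg
  have clG12 : Clause342 (G₁ i) 2 Bout δout U :=
    clause342_mono (clause342_e2_of_hasMajorantHom hcoG12
      (entry2_of_step (hgeo i) hrowi hθ hB₀ hρ.le hρS hρδ hS1.step1 h33.e2 hfix1 hq1) hC0 hlen)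
      hC0 hCle hδρ (S i).dist_nonneg hlen (S i).supNorm_nonneg
  -- the residual members, brought to (Bout, δout)
  have resK : ∀ K : B9.KernelFamily (geo i) (bg i), K ∈ [GD i, G₁ i] → Clause342 K 0 Bout δout U →
      Clause342 K 2 Bout δout U →
      B9.Ineq342_346_347_noLap K Bout δout U ∧ B9.Ineq343_345 K Bβ Bε Bεβ δout U ∧
        HasRWExpOfOps (𝔬 i) K U δout ∧ PosDefKOfOps (𝔬 i) K U := by
    intro K hK c0 c2
    obtain ⟨c1, hl2, hgl, hho⟩ := hresK K hK
    refine ⟨⟨eNoLap_of_clauses c0 ?_ c2, l2Block_mono (S i) hl2 hBoutB₁ hBout0 hδδ₁, fun n lam γ hn h1 h2 =>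
      (hgl n lam γ hn h1 h2).trans (mul_le_mul_of_nonneg_right hBoutB₁ ((S i).wNorm_nonneg γ lam))⟩,
      ineq343_345_mono (S i) hho (fun _ => le_rfl) hBβ (fun _ => le_rfl) hBε (fun _ _ => le_rfl) hBεβ hδδ₁,
      hasRWExp_of_schemas (hgeo i) hrowi hθ hσδ hq1 hS2 hI K δout, posDefK_of_schemas hr hF hI K⟩
    exact clause342_mono c1 hB₁ hBoutB₁ hδδ₁ (S i).dist_nonneg hlen (S i).supNorm_nonneg
  refine ⟨fun K hK => ?_, fun Hk' hK' => ?_⟩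
  · have hK2 : K = GD i ∨ K = G₁ i := by simpa using hK
    rcases hK2 with rfl | rfl
    · exact resK _ hK clG0 clG2
    · exact resK _ hK clG10 clG12
  · exact ⟨ineq3133_mono (S i) d (hresH Hk' hK') hBoutB₁ hBout0 hBβ hδδ₁,
      hasRWExpH_of_schemas (hgeo i) hrowi hθ hσδ hq1 hS2 hI Hk' δout⟩

end Family

end

end Literature.MathematicalPhysics.QuantumFieldTheory.Balaban1983to89.B9Thm312WholeLeaf
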